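import Literature.NumberTheory.EllipticCurves.ModularDegreeQuadraticTwistProofs
import Literature.NumberTheory.EllipticCurves.LFunctionCoefficientBound
import Literature.NumberTheory.EllipticCurves.NewformPeterssonSizeSymmSquareProofs
import HarnessLib

/-!
# The Euler factor at one prime of Rankin's series `Σ aₙ(E)² n⁻ʷ`, and the Rankin residues of a curve
# and of its quadratic twist by `p*` (Watkins 2002, §2.1 — the `L^A_p(Sym² E_p, 2)` factor) — proved

A proofs-only file (theorems only: no definition, no named fact; D-0026), the toolbox of
`ModularDegreeQuadraticTwistSemistableProofs` (Watkins' `V_p` at a prime of good or multiplicative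
reduction; M. Watkins, *Computing the modular degree of an elliptic curve*, Experiment. Math. **11**
(2002), §2.1 p. 491: "`V_p = (Ω_{E_p}/Ω_E)·(N_E/N_{E_p})·L^A_p(Sym² E_p, 2)^{-1}`").

* `tsum_eq_tsum_prime_pow_mul_tsum_ite_dvd`: for a non-negative summable multiplicative `g : ℕ → ℝ`,
  `Σₙ g n = (Σₖ g (p^k)) · Σ_{p ∤ n} g n` (unique factorisation `n = p^k m`).
* `tsum_sq_mul_pow_mul_eq_of_recurrence`: for `u₀ = 1, u₁ = a, u_{k+2} = a u_{k+1} − b uₖ`,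
  `(Σ uₖ² xᵏ)(1 − bx)((1 + bx)² − a²x) = 1 + bx` — the inverse Euler factor of `Σ aₙ² n⁻ʷ` at a good
  prime (recursion `a_{p^{k+2}} = a_p a_{p^{k+1}} − p a_{p^k}`, Diamond–Shurman (8.44)); at a
  multiplicative prime `a_{p^k} = (±1)^k` and the factor is geometric; `ψ(pM) = pψ(M)` (`p ∣ M`),
  `ψ(p²M) = p(p+1)ψ(M)` (`p ∤ M`).
* `rankinResidue_eq_mul_of_twist`: for `W' = C • (W ⊗ χ_{p*})` with `aₙ(W') = 0` for `p ∣ n`, Rankin's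
  series of the newform of `W'` is the `p ∤ n` part of that of `W` (`aₙ(W ⊗ χ_{p*}) = (n/p) aₙ(W)`), so by
  Rankin's residue at EACH level (tree `tendsto_sub_two_mul_tsum_normSq_cuspCoeff_div_rpow`): if the
  local sum `Σₖ a_{p^k}(W)² p^{-kw}` is `Φ(w)` for `w > 2` with `Φ` continuous at `2`, then
  `48π (f,f)/ψ(M) = Φ(2) · 48π (f',f')/ψ(N)` (data of `W` at level `M`, of `W'` at level `N`).

References: [Watkins2002] M. Watkins, Experiment. Math. 11 (2002) 487–502, §2.1 (p. 491);
[DiamondShurman2005] F. Diamond, J. Shurman, GTM 228, §8.8 (8.44); [SilvermanAEC2009] §C.16.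
-/

noncomputable section

open scoped MatrixGroups ModularForm Real Topology
open Filter CongruenceSubgroup IsDedekindDomain NumberField Rat.HeightOneSpectrum

namespace Literature.NumberTheory.EllipticCurves.ModularForms

/-! ### Splitting a multiplicative series at one prime -/

/-- **Euler factor at one prime.** For a non-negative summable `g : ℕ → ℝ` with `g 0 = 0` and
`g (m n) = g m · g n` for coprime `m, n`, and a prime `p`:
`Σₙ g n = (Σₖ g (p ^ k)) · Σₙ 𝟙[p ∤ n] g n` (unique factorisation `n = p^k · m`, `p ∤ m`; one Euler
factor of a multiplicative Dirichlet series, Diamond–Shurman Thm. 5.9.2 — here the factor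
`L^A_p(Sym² E_p, 2)` that Watkins removes). [cite: Watkins2002, §2.1 (p. 491)] [cite: DiamondShurman2005, Thm. 5.9.2 (Euler product)] -/
theorem tsum_eq_tsum_prime_pow_mul_tsum_ite_dvd {g : ℕ → ℝ} {p : ℕ} (hp : p.Prime)
    (hg0 : g 0 = 0) (hg : ∀ n, 0 ≤ g n) (hmul : ∀ m n : ℕ, m.Coprime n → g (m * n) = g m * g n)
    (hsum : Summable g) :
    ∑' n, g n = (∑' k, g (p ^ k)) * ∑' n, (if p ∣ n then 0 else g n) := by
  -- the coprime-to-`p` part as a sum over the subtype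
  set S : Set ℕ := {m : ℕ | ¬ p ∣ m} with hS
  have hTsum : ∑' n, (if p ∣ n then 0 else g n) = ∑' m : S, g m := by
    rw [tsum_subtype S g]
    refine tsum_congr fun n ↦ ?_
    by_cases h : p ∣ n
    · rw [if_pos h, Set.indicator_of_notMem (by simpa [hS] using h)]
    · rw [if_neg h, Set.indicator_of_mem (by simpa [hS] using h)]
  rw [hTsum]
  -- the parametrisation `(k, m) ↦ p ^ k * m`
  set φ : ℕ × S → ℕ := fun z ↦ p ^ z.1 * (z.2 : ℕ) with hφ
  have hφinj : Function.Injective φ := by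
    rintro ⟨k, m, hm⟩ ⟨k', m', hm'⟩ h
    simp only [hφ] at h
    have hm0 : m ≠ 0 := by rintro rfl; exact hm (dvd_zero p)
    have hm0' : m' ≠ 0 := by rintro rfl; exact hm' (dvd_zero p)
    have hk : k = k' := by
      have h1 := congrArg (fun n : ℕ ↦ n.factorization p) h
      simp only [Nat.factorization_mul (pow_ne_zero _ hp.ne_zero) hm0,
        Nat.factorization_mul (pow_ne_zero _ hp.ne_zero) hm0', hp.factorization_pow,
        Finsupp.coe_add, Pi.add_apply, Finsupp.single_eq_same,
        Nat.factorization_eq_zero_of_not_dvd hm, Nat.factorization_eq_zero_of_not_dvd hm'] at h1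
      simpa using h1
    subst hk
    have hmm : m = m' := Nat.eq_of_mul_eq_mul_left (pow_pos hp.pos k) h
    subst hmm
    rfl
  have hφsupp : Function.support g ⊆ Set.range φ := by
    intro n hn
    rw [Function.mem_support] at hn
    have hn0 : n ≠ 0 := by rintro rfl; exact hn hg0
    refine ⟨(n.factorization p, ⟨ordCompl[p] n, Nat.not_dvd_ordCompl hp hn0⟩), ?_⟩
    simp only [hφ]
    exact Nat.ordProj_mul_ordCompl_eq_self n p
  have h1 : ∑' n, g n = ∑' z : ℕ × S, g (φ z) := (hφinj.tsum_eq hφsupp).symm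
  rw [h1]
  -- multiplicativity on the parametrisation
  have h2 : ∀ z : ℕ × S, g (φ z) = g (p ^ z.1) * g (z.2 : ℕ) := by
    rintro ⟨k, m, hm⟩
    simp only [hφ]
    exact hmul _ _ (Nat.Coprime.pow_left k ((Nat.Prime.coprime_iff_not_dvd hp).mpr hm))
  simp_rw [h2]
  -- summability of the two factors
  have hs1 : Summable fun k : ℕ ↦ g (p ^ k) :=
    hsum.comp_injective (Nat.pow_right_injective hp.two_le)
  have hs2 : Summable fun m : S ↦ g (m : ℕ) := hsum.subtype _
  have hn1 : Summable fun k : ℕ ↦ ‖g (p ^ k)‖ :=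
    hs1.congr fun k ↦ by rw [Real.norm_eq_abs, abs_of_nonneg (hg _)]
  have hn2 : Summable fun m : S ↦ ‖g (m : ℕ)‖ :=
    hs2.congr fun m ↦ by rw [Real.norm_eq_abs, abs_of_nonneg (hg _)]
  rw [tsum_mul_tsum_of_summable_norm hn1 hn2]

/-! ### The index of `Γ₀`: `ψ(pM) = p ψ(M)` for `p ∣ M` -/

/-- `ψ(p · M) = p · ψ(M)` when the prime `p` divides `M ≠ 0` (`ψ(p^{e+1}) = p ψ(p^e)` for
`e ≥ 1`, multiplicativity; `ψ(N) = N ∏_{p ∣ N}(1 + 1/p)`, Diamond–Shurman §1.2 / Ex. 1.2.3,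
Shimura Prop. 1.43). [cite: DiamondShurman2005, §1.2 and Exercise 1.2.3 (index of Γ₀(N))] -/
theorem gamma0Index_mul_of_prime_dvd {p M : ℕ} (hp : p.Prime) (hM : M ≠ 0) (hpM : p ∣ M) :
    gamma0Index (p * M) = p * gamma0Index M := by
  set e := M.factorization p with he
  set M' := ordCompl[p] M with hM'
  have hdec : p ^ e * M' = M := Nat.ordProj_mul_ordCompl_eq_self M p
  have he1 : 1 ≤ e := (hp.dvd_iff_one_le_factorization hM).mp hpM
  have hcop : (p ^ e).Coprime M' :=
    Nat.Coprime.pow_left e ((Nat.coprime_ordCompl hp hM))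
  have hcop' : (p ^ (e + 1)).Coprime M' :=
    Nat.Coprime.pow_left (e + 1) ((Nat.coprime_ordCompl hp hM))
  have h1 : gamma0Index M = p ^ (e - 1) * (p + 1) * gamma0Index M' := by
    rw [← hdec, gamma0Index_mul hcop, gamma0Index_prime_pow hp (by omega)]
  have h2 : gamma0Index (p * M) = p ^ e * (p + 1) * gamma0Index M' := by
    rw [← hdec, ← mul_assoc, ← pow_succ', gamma0Index_mul hcop', gamma0Index_prime_pow hp (by omega),
      Nat.add_sub_cancel]
  rw [h1, h2]
  obtain ⟨d, hd⟩ : ∃ d, e = d + 1 := ⟨e - 1, by omega⟩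
  rw [hd, Nat.add_sub_cancel, pow_succ]
  ring

/-- `ψ(p² · M) = p (p + 1) · ψ(M)` when the prime `p` does not divide `M` (`ψ(p²) = p(p + 1)`,
multiplicativity). [cite: DiamondShurman2005, §1.2 and Exercise 1.2.3 (index of Γ₀(N))] -/
theorem gamma0Index_prime_sq_mul_of_not_dvd {p M : ℕ} (hp : p.Prime) (hpM : ¬ p ∣ M) :
    gamma0Index (p ^ 2 * M) = p * (p + 1) * gamma0Index M := by
  have hcop : (p ^ 2).Coprime M := Nat.Coprime.pow_left 2 ((Nat.Prime.coprime_iff_not_dvd hp).mpr hpM)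
  rw [gamma0Index_mul hcop, gamma0Index_prime_pow hp two_ne_zero]
  ring

/-! ### Local sums: `Σ uₖ² xᵏ` for a sequence with `u_{k+2} = a u_{k+1} − b uₖ` -/

/-- **Generating function of the squares of a second-order recurrence.** If `u₀ = 1`, `u₁ = a`,
`u_{k+2} = a u_{k+1} − b uₖ`, `0 ≤ x` and `Σ uₖ² xᵏ` converges, then
`(Σₖ uₖ² xᵏ) · (1 − b x) · ((1 + b x)² − a² x) = 1 + b x` (for `b = p`, `a = a_p` this is the
inverse of the Euler factor at `p` of Rankin's series `Σ aₙ² n⁻ʷ` at `x = p⁻ʷ`: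
`Σ a_{p^k}² xᵏ = (1 + p x)/((1 − p x)(1 − (a_p² − 2p) x + p² x²))`, Watkins' `L^A_p(Sym² E_p, 2)` up
to the `ζ`-type factor; Delaunay 2003, p. 674, the Euler factors of `L(Sym²ᵢ f, s)`). [cite: Watkins2002, §2.1 (p. 491)] [cite: Delaunay2003, (2) p. 674 (Euler factors of L(Sym² f, s))] -/
theorem tsum_sq_mul_pow_mul_eq_of_recurrence (u : ℕ → ℝ) (a b x : ℝ) (hu0 : u 0 = 1) (hu1 : u 1 = a)
    (hrec : ∀ k, u (k + 2) = a * u (k + 1) - b * u k) (hx : 0 ≤ x)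
    (hV : Summable fun k ↦ u k ^ 2 * x ^ k) :
    (∑' k, u k ^ 2 * x ^ k) * ((1 - b * x) * ((1 + b * x) ^ 2 - a ^ 2 * x)) = 1 + b * x := by
  -- shifted square sums
  have hV1 : Summable fun k ↦ u (k + 1) ^ 2 * x ^ (k + 1) := (summable_nat_add_iff 1).mpr hV
  have hV0eq : ∑' k, u k ^ 2 * x ^ k = 1 + ∑' k, u (k + 1) ^ 2 * x ^ (k + 1) := by
    rw [hV.tsum_eq_zero_add, hu0, one_pow, pow_zero, one_mul]
  have hV1eq : ∑' k, u (k + 1) ^ 2 * x ^ (k + 1) = a ^ 2 * x + ∑' k, u (k + 2) ^ 2 * x ^ (k + 2) := by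
    rw [hV1.tsum_eq_zero_add, zero_add, hu1, pow_one]
  -- `Σ u_{k+1}² xᵏ` converges too
  have hV1' : Summable fun k ↦ u (k + 1) ^ 2 * x ^ k := by
    by_cases hx0 : x = 0
    · subst hx0
      refine (summable_nat_add_iff 1).mp ?_
      have : (fun k : ℕ ↦ u (k + 1 + 1) ^ 2 * (0 : ℝ) ^ (k + 1)) = fun _ ↦ 0 := by
        funext k
        rw [zero_pow (Nat.succ_ne_zero k), mul_zero]
      rw [this]
      exact summable_zero
    · refine (hV1.mul_left x⁻¹).congr fun k ↦ ?_
      field_simp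
      ring
  -- the mixed sum `Σ uₖ u_{k+1} xᵏ` converges absolutely: `|uₖ u_{k+1}| ≤ uₖ² + u_{k+1}²`
  have hC : Summable fun k ↦ u k * u (k + 1) * x ^ k := by
    refine Summable.of_norm_bounded (g := fun k ↦ u k ^ 2 * x ^ k + u (k + 1) ^ 2 * x ^ k)
      (hV.add hV1') fun k ↦ ?_
    rw [Real.norm_eq_abs, abs_mul, abs_mul, abs_pow, abs_of_nonneg hx]
    have h2 : |u k| * |u (k + 1)| ≤ u k ^ 2 + u (k + 1) ^ 2 := by
      nlinarith [sq_nonneg (|u k| - |u (k + 1)|), sq_abs (u k), sq_abs (u (k + 1))]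
    calc |u k| * |u (k + 1)| * x ^ k ≤ (u k ^ 2 + u (k + 1) ^ 2) * x ^ k :=
          mul_le_mul_of_nonneg_right h2 (pow_nonneg hx k)
      _ = u k ^ 2 * x ^ k + u (k + 1) ^ 2 * x ^ k := by ring
  have hC0eq : ∑' k, u k * u (k + 1) * x ^ k = a + ∑' k, u (k + 1) * u (k + 2) * x ^ (k + 1) := by
    rw [hC.tsum_eq_zero_add, zero_add, hu0, hu1, pow_zero, one_mul, mul_one]
  -- (R1): the recurrence times `u_{k+1} x^{k+1}`, summed
  have hR1 : ∑' k, u (k + 1) * u (k + 2) * x ^ (k + 1) =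
      a * ∑' k, u (k + 1) ^ 2 * x ^ (k + 1) - b * x * ∑' k, u k * u (k + 1) * x ^ k := by
    rw [← tsum_mul_left, ← tsum_mul_left, ← (hV1.mul_left a).tsum_sub (hC.mul_left (b * x))]
    exact tsum_congr fun k ↦ by rw [hrec k]; ring
  -- (R2): the squared recurrence times `x^{k+2}`, summed
  have hR2 : ∑' k, u (k + 2) ^ 2 * x ^ (k + 2) =
      a ^ 2 * x * ∑' k, u (k + 1) ^ 2 * x ^ (k + 1)
        - 2 * a * b * x ^ 2 * ∑' k, u k * u (k + 1) * x ^ k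
        + b ^ 2 * x ^ 2 * ∑' k, u k ^ 2 * x ^ k := by
    rw [← tsum_mul_left, ← tsum_mul_left, ← tsum_mul_left,
      ← (hV1.mul_left _).tsum_sub (hC.mul_left _),
      ← ((hV1.mul_left _).sub (hC.mul_left _)).tsum_add (hV.mul_left _)]
    exact tsum_congr fun k ↦ by rw [hrec k]; ring
  -- algebra on the five sums
  generalize ∑' k, u k ^ 2 * x ^ k = V at *
  generalize ∑' k, u (k + 1) ^ 2 * x ^ (k + 1) = V₁ at *
  generalize ∑' k, u (k + 2) ^ 2 * x ^ (k + 2) = V₂ at *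
  generalize ∑' k, u k * u (k + 1) * x ^ k = C at *
  generalize ∑' k, u (k + 1) * u (k + 2) * x ^ (k + 1) = C₁ at *
  have hC' : (1 + b * x) * C = a * V := by linear_combination hC0eq + hR1 - a * hV0eq
  have hV1' : V₁ = V - 1 := by linear_combination -hV0eq
  have hV2' : V₂ = V - 1 - a ^ 2 * x := by linear_combination (-1 : ℝ) * hV1eq - hV0eq
  rw [hV2', hV1'] at hR2
  linear_combination (1 + b * x) * hR2 - 2 * a * b * x ^ 2 * hC'

/-- **Geometric local sum** (multiplicative case): if `uₖ² = 1` for all `k` and `0 ≤ x < 1` then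
`Σ uₖ² xᵏ = (1 − x)⁻¹` (the Euler factor at a multiplicative prime, `a_{p^k} = ±1`). [cite: Watkins2002, §2.1 (p. 491)] -/
theorem tsum_sq_mul_pow_eq_of_sq_eq_one (u : ℕ → ℝ) {x : ℝ} (hu : ∀ k, u k ^ 2 = 1) (hx : 0 ≤ x)
    (hx1 : x < 1) : ∑' k, u k ^ 2 * x ^ k = (1 - x)⁻¹ := by
  simp_rw [hu, one_mul]
  exact tsum_geometric_of_lt_one hx hx1


section Coefficients

variable {W W' : WeierstrassCurve ℚ} {p : ℕ}

/-- `aₙ(C • (W ⊗ χ_{p*}))² = aₙ(W)²` for `p ∤ n` (`aₙ(W ⊗ χ_{p*}) = (n/p) aₙ(W)`, `(n/p)² = 1`;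
Silverman, *AEC* X.2, Exercise 10.16). [cite: SilvermanAEC2009, X.2 Exercise 10.16] [cite: Watkins2002, §2.1 (p. 491)] -/
theorem sq_LFunction_eq_of_smul_quadraticTwist_pStar [W.IsElliptic] [Fact p.Prime] (hp2 : p ≠ 2)
    (C : WeierstrassCurve.VariableChange ℚ)
    (hW' : C • W.quadraticTwist (((-1 : ℤ) ^ (p / 2) * p : ℤ) : ℚ) = W') {n : ℕ} (hn : ¬ p ∣ n) :
    W'.LFunction n ^ 2 = W.LFunction n ^ 2 := by
  have hd0 : ((((-1 : ℤ) ^ (p / 2) * p : ℤ) : ℚ)) ≠ 0 := by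
    push_cast
    exact mul_ne_zero (pow_ne_zero _ (by norm_num)) (by exact_mod_cast (Fact.out : p.Prime).ne_zero)
  haveI := W.isElliptic_quadraticTwist hd0
  rw [← hW', WeierstrassCurve.LFunction_smul, W.LFunction_quadraticTwist_pStar_apply hp2 hn, mul_pow]
  have hne : ((n : ℤ) : ZMod p) ≠ 0 := by
    rw [Int.cast_natCast, Ne, ZMod.natCast_eq_zero_iff]
    exact hn
  rw [legendreSym.sq_one p hne, one_mul]

/-- The Rankin term of the newform of `W`: `‖aₙ(f)‖² / n^w = aₙ(W)² / n^w` (`aₙ(f) = aₙ(W) ∈ ℤ`). [cite: Rankin1939, convergence of Σ|aₙ|²n^{-s} for Re s > k] -/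
theorem normSq_cuspCoeff_div_rpow_eq_sq_LFunction {N : ℕ} [NeZero N] {f : CuspForm (Gamma0 N) 2}
    (hf : IsNewformOf W f) (w : ℝ) (n : ℕ) :
    ‖cuspCoeff f n‖ ^ 2 / (n : ℝ) ^ w = (W.LFunction n : ℝ) ^ 2 / (n : ℝ) ^ w := by
  rw [hf.2 n, Complex.norm_intCast, sq_abs]

/-- The Rankin terms `g_w(n) = aₙ(W)² / n^w` are multiplicative in `n` (`a_{mn} = a_m a_n`,
Diamond–Shurman (8.44)). [cite: DiamondShurman2005, §8.8 (8.44)] -/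
theorem sq_LFunction_div_rpow_mul_of_coprime (W : WeierstrassCurve ℚ) (w : ℝ) {m n : ℕ}
    (h : m.Coprime n) :
    (W.LFunction (m * n) : ℝ) ^ 2 / ((m * n : ℕ) : ℝ) ^ w =
      ((W.LFunction m : ℝ) ^ 2 / (m : ℝ) ^ w) * ((W.LFunction n : ℝ) ^ 2 / (n : ℝ) ^ w) := by
  rw [W.isMultiplicative_LFunction.map_mul_of_coprime h, Int.cast_mul, Nat.cast_mul,
    Real.mul_rpow (Nat.cast_nonneg m) (Nat.cast_nonneg n)]
  ring

/-- The Rankin term at a prime power: `a_{p^k}² / (p^k)^w = a_{p^k}² · (p^{-w})^k`. [cite: Rankin1939, convergence of Σ|aₙ|²n^{-s} for Re s > k] -/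
theorem sq_LFunction_div_rpow_prime_pow (W : WeierstrassCurve ℚ) (p : ℕ) (w : ℝ) (k : ℕ) :
    (W.LFunction (p ^ k) : ℝ) ^ 2 / ((p ^ k : ℕ) : ℝ) ^ w =
      (W.LFunction (p ^ k) : ℝ) ^ 2 * ((p : ℝ) ^ (-w)) ^ k := by
  have hp0 : (0 : ℝ) ≤ p := Nat.cast_nonneg p
  rw [Nat.cast_pow, ← Real.rpow_natCast (p : ℝ) k, ← Real.rpow_mul hp0, mul_comm, Real.rpow_mul hp0,
    Real.rpow_natCast, Real.rpow_neg hp0, inv_pow, div_eq_mul_inv]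

end Coefficients


/-! ### Local data at a semistable prime -/

section Local

variable (W : WeierstrassCurve ℚ) [W.IsElliptic] (p : ℕ) [Fact p.Prime]

omit [W.IsElliptic] in
/-- **Recursion at a good prime**: `a_{p^{k+2}} = a_p a_{p^{k+1}} − p a_{p^k}` (Diamond–Shurman (8.44);
the tree's `LFunction_apply_prime_pow_add_two` at the place of `𝓞 ℚ` over `p`, good reduction
transported along `ℚ_v ≃ ℚ_[p]`). [cite: DiamondShurman2005, §8.8 (8.44)] -/
theorem LFunction_prime_pow_add_two_of_hasGoodReductionAtPrime (hgood : W.HasGoodReductionAtPrime p)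
    (k : ℕ) :
    W.LFunction (p ^ (k + 2)) = W.LFunction p * W.LFunction (p ^ (k + 1)) - p * W.LFunction (p ^ k) := by
  have hp : p.Prime := Fact.out
  obtain ⟨v, hv⟩ : ∃ v : HeightOneSpectrum (𝓞 ℚ), primesEquiv v = ⟨p, hp⟩ :=
    ⟨(primesEquiv (R := 𝓞 ℚ)).symm ⟨p, hp⟩, Equiv.apply_symm_apply _ _⟩
  have hvp : (primesEquiv v : ℕ) = p := by rw [hv]
  have hg := W.hasGoodReductionAtPrime_iff_hasGoodReductionAt_ringOfIntegers v
  rw [hv] at hg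
  have hgv : W.HasGoodReductionAt v := hg.mp hgood
  have h := W.LFunction_apply_prime_pow_add_two v k
  rw [if_pos hgv, hvp] at h
  exact h

/-- **At a multiplicative prime `a_{p^k} = a_p^k` and `a_p² = 1`** (local factor `1 ∓ T`;
Silverman, *AEC* §C.16). [cite: SilvermanAEC2009, §C.16 (definition of L_v(T))] -/
theorem LFunction_prime_pow_of_hasMultiplicativeReductionAtPrime
    (hmult : W.HasMultiplicativeReductionAtPrime p) (k : ℕ) :
    W.LFunction (p ^ k) = W.LFunction p ^ k ∧ W.LFunction p ^ 2 = 1 := by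
  have hp : p.Prime := Fact.out
  obtain ⟨v, hv⟩ : ∃ v : HeightOneSpectrum (𝓞 ℚ), primesEquiv v = ⟨p, hp⟩ :=
    ⟨(primesEquiv (R := 𝓞 ℚ)).symm ⟨p, hp⟩, Equiv.apply_symm_apply _ _⟩
  have hvp : (primesEquiv v : ℕ) = p := by rw [hv]
  have hm := W.hasMultiplicativeReductionAtPrime_iff_hasMultiplicativeReductionAt_ringOfIntegers v
  rw [hv] at hm
  have hmv : W.HasMultiplicativeReductionAt v := hm.mp hmult
  have hngv : ¬ W.HasGoodReductionAt v := hmv.not_hasGoodReductionAt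
  have hsq : W.LFunction p ^ 2 = 1 := by
    by_cases hs : W.HasSplitMultiplicativeReductionAt v
    · have h1 := W.LFunction_apply_primesEquiv_of_hasSplitMultiplicativeReductionAt hs
      rw [hvp] at h1
      rw [h1, one_pow]
    · have h1 := W.LFunction_apply_primesEquiv_of_hasMultiplicativeReductionAt_of_not_split hmv hs
      rw [hvp] at h1
      rw [h1]
      norm_num
  refine ⟨?_, hsq⟩
  -- the recursion with the `q_v T²` term absent
  have hrec : ∀ k, W.LFunction (p ^ (k + 2)) = W.LFunction p * W.LFunction (p ^ (k + 1)) := by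
    intro k
    have h := W.LFunction_apply_prime_pow_add_two v k
    rw [if_neg hngv, hvp, zero_mul, sub_zero] at h
    exact h
  induction k using Nat.strong_induction_on with
  | _ k ih =>
    match k with
    | 0 => rw [pow_zero, pow_zero]; exact W.isMultiplicative_LFunction.map_one
    | 1 => rw [pow_one, pow_one]
    | k + 2 => rw [hrec k, ih (k + 1) (by omega), ← pow_succ']

/-- **Hasse at `p` in squared form**: `a_p(W)² ≤ 4p` (Silverman, *AEC* V.1 Thm. 1.1; tree
`abs_LFunction_prime_pow_le`). [cite: SilvermanAEC2009, V.1 Thm. 1.1 (Hasse)] -/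
theorem sq_LFunction_prime_le : (W.LFunction p : ℝ) ^ 2 ≤ 4 * p := by
  have hp : p.Prime := Fact.out
  have h := W.abs_LFunction_prime_pow_le hp 1
  rw [pow_one, pow_one] at h
  have h0 : 0 ≤ (1 + 1 : ℝ) * Real.sqrt p := by positivity
  have h2 : |(W.LFunction p : ℝ)| ^ 2 ≤ ((1 + 1 : ℝ) * Real.sqrt p) ^ 2 :=
    pow_le_pow_left₀ (abs_nonneg _) (by exact_mod_cast h) 2
  rw [sq_abs, mul_pow, Real.sq_sqrt (Nat.cast_nonneg p)] at h2
  linarith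

end Local

/-! ### The Rankin residues of `W` and of its twist -/

section Rankin

variable {W W' : WeierstrassCurve ℚ} [W.IsElliptic] {p : ℕ} [Fact p.Prime] {M N : ℕ} [NeZero M] [NeZero N]

/-- The Rankin series of the newform of `W' = C • (W ⊗ χ_{p*})`, additive at `p`, is the `p ∤ n`
part of that of `W`: `Σ ‖aₙ(f')‖² n⁻ʷ = Σ_{p ∤ n} aₙ(W)² n⁻ʷ`. [cite: Watkins2002, §2.1 (p. 491)] -/
theorem tsum_normSq_cuspCoeff_div_rpow_twist_eq (hp2 : p ≠ 2) (C : WeierstrassCurve.VariableChange ℚ)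
    (hW' : C • W.quadraticTwist (((-1 : ℤ) ^ (p / 2) * p : ℤ) : ℚ) = W')
    (hW'0 : ∀ n : ℕ, p ∣ n → W'.LFunction n = 0) (D' : ModularParametrizationData W' N) (w : ℝ) :
    ∑' n : ℕ, ‖cuspCoeff D'.f n‖ ^ 2 / (n : ℝ) ^ w =
      ∑' n : ℕ, (if p ∣ n then 0 else (W.LFunction n : ℝ) ^ 2 / (n : ℝ) ^ w) := by
  refine tsum_congr fun n ↦ ?_
  rw [normSq_cuspCoeff_div_rpow_eq_sq_LFunction D'.isNewformOf]
  by_cases hn : p ∣ n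
  · rw [if_pos hn, hW'0 n hn]
    simp
  · rw [if_neg hn, ← Int.cast_pow, sq_LFunction_eq_of_smul_quadraticTwist_pStar hp2 C hW' hn,
      Int.cast_pow]

/-- **The Rankin residues of `W` and `W'` differ by the Euler factor at `p`.** If for `w > 2` the
local sum `Σₖ a_{p^k}(W)² p^{-kw}` equals `Φ(w)` with `Φ` continuous at `w = 2`, then
`48π (f, f)/ψ(M) = Φ(2) · 48π (f', f')/ψ(N)` for parametrisation data `D` of `W` at level `M` and
`D'` of `W' = C • (W ⊗ χ_{p*})` (additive at `p`) at level `N` (Rankin's residue at each level,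
`tendsto_sub_two_mul_tsum_normSq_cuspCoeff_div_rpow`, and the splitting of the series of `W` at
`p`). [cite: Watkins2002, §2.1 (p. 491)] -/
theorem rankinResidue_eq_mul_of_twist (hp2 : p ≠ 2) (C : WeierstrassCurve.VariableChange ℚ)
    (hW' : C • W.quadraticTwist (((-1 : ℤ) ^ (p / 2) * p : ℤ) : ℚ) = W')
    (hW'0 : ∀ n : ℕ, p ∣ n → W'.LFunction n = 0)
    (D : ModularParametrizationData W M) (D' : ModularParametrizationData W' N)
    {Φ : ℝ → ℝ} (hΦ2 : ContinuousAt Φ 2)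
    (hΦ : ∀ w : ℝ, 2 < w → ∑' k : ℕ, (W.LFunction (p ^ k) : ℝ) ^ 2 * ((p : ℝ) ^ (-w)) ^ k = Φ w) :
    48 * π * (peterssonProduct (Gamma0 M) 2 D.f D.f).re / gamma0Index M =
      Φ 2 * (48 * π * (peterssonProduct (Gamma0 N) 2 D'.f D'.f).re / gamma0Index N) := by
  have hp : p.Prime := Fact.out
  have hG := tendsto_sub_two_mul_tsum_normSq_cuspCoeff_div_rpow D.f
  have hE := tendsto_sub_two_mul_tsum_normSq_cuspCoeff_div_rpow D'.f
  -- the series of `W` splits at `p`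
  have key : ∀ w : ℝ, 2 < w →
      (w - 2) * ∑' n : ℕ, ‖cuspCoeff D.f n‖ ^ 2 / (n : ℝ) ^ w =
        Φ w * ((w - 2) * ∑' n : ℕ, ‖cuspCoeff D'.f n‖ ^ 2 / (n : ℝ) ^ w) := by
    intro w hw
    set g : ℕ → ℝ := fun n ↦ (W.LFunction n : ℝ) ^ 2 / (n : ℝ) ^ w with hg
    have hsum : Summable g :=
      (summable_normSq_cuspCoeff_div_rpow D.f hw).congr fun n ↦ normSq_cuspCoeff_div_rpow_eq_sq_LFunction D.isNewformOf w n
    have hsplit := tsum_eq_tsum_prime_pow_mul_tsum_ite_dvd (g := g) hp (by simp [hg])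
      (fun n ↦ by positivity) (fun m n h ↦ sq_LFunction_div_rpow_mul_of_coprime W w h) hsum
    have hGser : ∑' n : ℕ, ‖cuspCoeff D.f n‖ ^ 2 / (n : ℝ) ^ w = ∑' n, g n :=
      tsum_congr fun n ↦ normSq_cuspCoeff_div_rpow_eq_sq_LFunction D.isNewformOf w n
    have hloc : ∑' k : ℕ, g (p ^ k) = Φ w := by
      rw [← hΦ w hw]
      exact tsum_congr fun k ↦ sq_LFunction_div_rpow_prime_pow W p w k
    rw [hGser, hsplit, hloc, tsum_normSq_cuspCoeff_div_rpow_twist_eq hp2 C hW' hW'0 D' w]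
    ring
  have hlim : Tendsto (fun w : ℝ ↦ (w - 2) * ∑' n : ℕ, ‖cuspCoeff D.f n‖ ^ 2 / (n : ℝ) ^ w) (𝓝[>] 2)
      (𝓝 (Φ 2 * (48 * π * (peterssonProduct (Gamma0 N) 2 D'.f D'.f).re / gamma0Index N))) := by
    have h1 : Tendsto Φ (𝓝[>] 2) (𝓝 (Φ 2)) := hΦ2.tendsto.mono_left nhdsWithin_le_nhds
    refine (h1.mul hE).congr' ?_
    filter_upwards [self_mem_nhdsWithin] with w hw
    exact (key w hw).symm
  exact tendsto_nhds_unique hG hlim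

end Rankin
end Literature.NumberTheory.EllipticCurves.ModularForms

end
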